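import Literature.Combinatorics.SimpleGraph.WallTopologicalMinor
import Literature.Computability.MetaComplexity.TseitinDepthFrege
import HarnessLib

/-!
# The brick graph inside the wall, and the grid Tseitin system

Combinatorial support for the (conditional) discharge of
`Literature.Computability.MetaComplexity.galesiEtAl_tseitin_treewidth_depthFrege_lowerBound`
(Galesi–Itsykson–Riazanov–Sofronova, APAL 2023, Thm. 18; `TseitinDepthFrege.lean`). The printed
proof (§3.2, Lemma 16 and §3.3) passes from a wall `W_r` (a topological minor of the graph, Cor. 9)
to a grid: "Consider a set `I` of all the horizontal edges of `W_n` that belong to odd columns … `I`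
is a matching … If we contract all edges from `I`, we get the graph `M_n` that … coincides with
`𝓗_{n,⌊(n-1)/2⌋}` [up to boundary effects]", and then (Lemma 12) to a square sub-grid. We organise
this as ONE finite object, the **brick graph** `bricks k`: its vertices are the cells `(i, c)` of
the grid `𝓗_{k,k}` doubled into a left and a right copy, its edges are the *matching* edges
`(w, L) — (w, R)`, the *horizontal* edges `((i,c), R) — ((i,c+1), L)` and the *vertical* edges
`((i,c), L) — ((i+1,c), R)`; contracting the matching gives exactly `𝓗_{k,k}`, and `bricks k` is a
subgraph of the wall `W_{3k+3}` (`bricksHom`, the map `((i,c), b) ↦ (i, 2c + 2⌈k/2⌉ - i + b)`), hence a topological minor of every graph having `W_{3k+3}` as a topological minor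
(`bricks_isTopologicalMinor`). So the reduction needs a single substitution (suppression of the
subdivision paths, contraction of the matching) instead of the printed chain of four.

* `Bricks.BEdge k`, `Bricks.lend`, `Bricks.rend`, `bricks k` — edges are indexed by a sum type
  (matching ⊕ horizontal ⊕ vertical); every edge joins a left vertex `(lend e, false)` to a right
  vertex `(rend e, true)` (`bricks_adj_iff`).
* `GridEdge k`, `gridEnds`, `IsGridTseitinSystem k E` — "`E` is the Tseitin system of `𝓗_{k,k}`
  with some charges": rows ↔ grid vertices and variables ↔ grid edges bijectively, coefficient `1`
  exactly at the two ends; `gridSystem k f` and `isGridTseitinSystem_gridSystem` (non-vacuity).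
* `bricksHom k : bricks k →g wall (3 * k + 3)`, `bricksHom_injective`, `bricks_isTopologicalMinor`;
  sub-walls `wallIncl : wall a →g wall b` (`a ≤ b`), `wall_isTopologicalMinor_of_le`.

All statements are proved.

## References

* [GalesiEtAl2023] N. Galesi, D. Itsykson, A. Riazanov, A. Sofronova, *Bounded-depth Frege
  complexity of Tseitin formulas for all graphs*, Ann. Pure Appl. Logic 174 (2023) 103166, §2
  (grids `𝓗_{m,n}`, walls `W_n`), §3.2 (Lemma 16: the matching `I`, `M_n ⊇ 𝓗_{n,⌊(n-1)/2⌋}`), §3.3.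
  Read: APAL text pp. 9–16.
-/

namespace Literature.Computability.MetaComplexity

open Literature.Combinatorics.SimpleGraph

/-! ### The grid Tseitin system -/

/-- The edges of the grid `𝓗_{k,k}`: horizontal edges `(i, c) — (i, c+1)` indexed by
`(i, c) ∈ [0,k] × [0,k)`, vertical edges `(i, c) — (i+1, c)` indexed by `(i, c) ∈ [0,k) × [0,k]`.
[cite: GalesiEtAl2023, §2 (grids: "n(m+1) horizontal and m(n+1) vertical edges")] -/
abbrev GridEdge (k : ℕ) : Type := (Fin (k + 1) × Fin k) ⊕ (Fin k × Fin (k + 1))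

/-- The two ends of a grid edge (listed as (farther, nearer) end: `((i,c+1), (i,c))` for a
horizontal edge, `((i,c), (i+1,c))` for a vertical one). [cite: GalesiEtAl2023, §2 (grids)] -/
def gridEnds {k : ℕ} : GridEdge k → (Fin (k + 1) × Fin (k + 1)) × (Fin (k + 1) × Fin (k + 1))
  | Sum.inl (i, c) => ((i, c.succ), (i, c.castSucc))
  | Sum.inr (i, c) => ((i.castSucc, c), (i.succ, c))

/-- Ends of a horizontal grid edge. [folklore] -/
@[simp] theorem gridEnds_inl {k : ℕ} (i : Fin (k + 1)) (c : Fin k) :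
    gridEnds (Sum.inl (i, c) : GridEdge k) = ((i, c.succ), (i, c.castSucc)) := rfl

/-- Ends of a vertical grid edge. [folklore] -/
@[simp] theorem gridEnds_inr {k : ℕ} (i : Fin k) (c : Fin (k + 1)) :
    gridEnds (Sum.inr (i, c) : GridEdge k) = ((i.castSucc, c), (i.succ, c)) := rfl

/-- The two ends of a grid edge are adjacent in the grid `𝓗_{k,k}`. [cite: GalesiEtAl2023, §2] -/
theorem grid_adj_gridEnds {k : ℕ} (ε : GridEdge k) : (grid k k).Adj (gridEnds ε).1 (gridEnds ε).2 := by
  rcases ε with ⟨i, c⟩ | ⟨i, c⟩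
  · rw [grid_adj]; exact Or.inl ⟨rfl, Or.inr (by simp [gridEnds])⟩
  · rw [grid_adj]; exact Or.inr ⟨rfl, Or.inl (by simp [gridEnds])⟩

/-- The two ends of a grid edge are distinct. [folklore] -/
theorem gridEnds_fst_ne_snd {k : ℕ} (ε : GridEdge k) : (gridEnds ε).1 ≠ (gridEnds ε).2 :=
  (grid_adj_gridEnds ε).ne

/-- `IsGridTseitinSystem k E`: the system `E` over `𝔽₂` **is a Tseitin system of the grid
`𝓗_{k,k}`** (with arbitrary charges): its rows are in bijection with the grid vertices and its
variables with the grid edges so that the coefficient of a variable in a row is `1` if the row's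
vertex is an end of the variable's edge and `0` otherwise; the right-hand sides (charges) are
unconstrained. Then `sumEncoding 1 E` is the Tseitin formula `T(𝓗_{k,k}, f)` (one canonical parity
CNF per vertex). [cite: GalesiEtAl2023, §2 (Tseitin formulas; grids)] -/
def IsGridTseitinSystem (k : ℕ) {m v : ℕ} (E : Fin m → LinEqMod 2 v) : Prop :=
  ∃ (φ : Fin m ≃ Fin (k + 1) × Fin (k + 1)) (ψ : Fin v ≃ GridEdge k),
    ∀ i j, (E i).1 j = if φ i = (gridEnds (ψ j)).1 ∨ φ i = (gridEnds (ψ j)).2 then 1 else 0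

/-- The grid Tseitin system with charges `f`, in the numbering of rows and variables given by
`Fintype.equivFin`. [cite: GalesiEtAl2023, §2 (Tseitin formulas; grids)] -/
noncomputable def gridSystem (k : ℕ) (f : Fin (k + 1) × Fin (k + 1) → ZMod 2) :
    Fin (Fintype.card (Fin (k + 1) × Fin (k + 1))) → LinEqMod 2 (Fintype.card (GridEdge k)) :=
  fun i =>
    (fun j => if (Fintype.equivFin _).symm i = (gridEnds ((Fintype.equivFin (GridEdge k)).symm j)).1 ∨
        (Fintype.equivFin _).symm i = (gridEnds ((Fintype.equivFin (GridEdge k)).symm j)).2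
      then 1 else 0,
     f ((Fintype.equivFin _).symm i))

/-- `gridSystem k f` is a grid Tseitin system (non-vacuity of `IsGridTseitinSystem`). [folklore] -/
theorem isGridTseitinSystem_gridSystem (k : ℕ) (f : Fin (k + 1) × Fin (k + 1) → ZMod 2) :
    IsGridTseitinSystem k (gridSystem k f) :=
  ⟨(Fintype.equivFin _).symm, (Fintype.equivFin _).symm, fun _ _ => rfl⟩

/-- The charge of a row of `gridSystem k f`. [folklore] -/
@[simp] theorem gridSystem_snd (k : ℕ) (f : Fin (k + 1) × Fin (k + 1) → ZMod 2) (i) :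
    (gridSystem k f i).2 = f ((Fintype.equivFin _).symm i) := rfl

/-! ### The brick graph -/

namespace Bricks

/-- Edges of the brick graph `bricks k`: a matching edge at every cell `w` (`Sum.inl w`), and one
edge for every edge of the grid `𝓗_{k,k}` (`Sum.inr ε`). [cite: GalesiEtAl2023, Lemma 16 (the
matching `I` of the wall and the edges of `M_n`)] -/
abbrev BEdge (k : ℕ) : Type := (Fin (k + 1) × Fin (k + 1)) ⊕ GridEdge k

/-- The cell of the LEFT end of a brick edge: `w` for the matching edge at `w`, `(i, c+1)` for the
horizontal grid edge `(i,c) — (i,c+1)`, `(i, c)` for the vertical grid edge `(i,c) — (i+1,c)`.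
[cite: GalesiEtAl2023, Lemma 16] -/
def lend {k : ℕ} : BEdge k → Fin (k + 1) × Fin (k + 1)
  | Sum.inl w => w
  | Sum.inr ε => (gridEnds ε).1

/-- The cell of the RIGHT end of a brick edge: `w` for the matching edge at `w`, `(i, c)` for the
horizontal grid edge `(i,c) — (i,c+1)`, `(i+1, c)` for the vertical grid edge `(i,c) — (i+1,c)`.
[cite: GalesiEtAl2023, Lemma 16] -/
def rend {k : ℕ} : BEdge k → Fin (k + 1) × Fin (k + 1)
  | Sum.inl w => w
  | Sum.inr ε => (gridEnds ε).2

/-- A brick edge is determined by its two end cells. [folklore] -/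
theorem BEdge.ext_ends {k : ℕ} {e e' : BEdge k} (h₁ : lend e = lend e') (h₂ : rend e = rend e') :
    e = e' := by
  rcases e with w | ⟨⟨i, c⟩ | ⟨i, c⟩⟩ <;> rcases e' with w' | ⟨⟨i', c'⟩ | ⟨i', c'⟩⟩ <;>
    simp only [lend, rend, gridEnds_inl, gridEnds_inr, Prod.ext_iff, Fin.ext_iff, Fin.val_succ,
      Fin.val_castSucc] at h₁ h₂
  · obtain ⟨a, b⟩ := w; obtain ⟨a', b'⟩ := w'
    have ha : a = a' := Fin.ext h₁.1
    have hb : b = b' := Fin.ext h₁.2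
    subst ha; subst hb; rfl
  · exfalso; omega
  · exfalso; omega
  · exfalso; omega
  · have hi : i = i' := Fin.ext h₁.1
    have hc : c = c' := Fin.ext (by omega)
    subst hi; subst hc; rfl
  · exfalso; omega
  · exfalso; omega
  · exfalso; omega
  · have hi : i = i' := Fin.ext (by omega)
    have hc : c = c' := Fin.ext h₁.2
    subst hi; subst hc; rfl

end Bricks

open Bricks

/-- The **brick graph** `bricks k` on the doubled cells `(w, b)`, `w ∈ [0,k]²`, `b = false/true`
(left/right copy): `(lend e, false) — (rend e, true)` for every brick edge `e`, i.e. the matching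
edges `(w,L) — (w,R)`, the horizontal edges `((i,c),R) — ((i,c+1),L)` and the vertical edges
`((i,c),L) — ((i+1,c),R)`. It is the part `W'` of the wall whose contraction along the matching is
the grid `𝓗_{k,k}` (GIRS Lemma 16 restricted to a square window). [cite: GalesiEtAl2023, Lemma 16] -/
def bricks (k : ℕ) : SimpleGraph ((Fin (k + 1) × Fin (k + 1)) × Bool) where
  Adj p q := ∃ e : BEdge k, (p = (lend e, false) ∧ q = (rend e, true)) ∨
    (q = (lend e, false) ∧ p = (rend e, true))
  symm := ⟨fun p q ⟨e, h⟩ => ⟨e, h.symm⟩⟩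
  loopless := ⟨fun p ⟨e, h⟩ => by
    rcases h with ⟨h1, h2⟩ | ⟨h1, h2⟩ <;>
    · have := congrArg Prod.snd (h1.symm.trans h2); simp at this⟩

/-- The defining adjacency of the brick graph. [folklore] -/
theorem bricks_adj_edge {k : ℕ} (e : BEdge k) : (bricks k).Adj (lend e, false) (rend e, true) :=
  ⟨e, Or.inl ⟨rfl, rfl⟩⟩

/-- Adjacency in the brick graph, unfolded. [folklore] -/
theorem bricks_adj_iff {k : ℕ} {p q : (Fin (k + 1) × Fin (k + 1)) × Bool} :
    (bricks k).Adj p q ↔ ∃ e : BEdge k, (p = (lend e, false) ∧ q = (rend e, true)) ∨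
      (q = (lend e, false) ∧ p = (rend e, true)) :=
  Iff.rfl

/-! ### The brick graph is a subgraph of the wall `W_{3k+3}` -/

namespace Bricks

/-- The column of the wall `W_{3k+3}` holding the doubled cell `((i, c), b)`:
`2c + 2⌈k/2⌉ - i + b` (`= 2 (c + ⌈k/2⌉ - ⌈i/2⌉) + (i mod 2) + b`).
[cite: GalesiEtAl2023, Lemma 16 (Fig. 4–5)] -/
def wallCol (k i c : ℕ) (b : Bool) : ℕ :=
  2 * c + 2 * ((k + 1) / 2) - i + (if b then 1 else 0)

/-- `k ≤ 2 ⌈k/2⌉ ≤ k + 1`. [folklore] -/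
theorem two_mul_half_bounds (k : ℕ) : k ≤ 2 * ((k + 1) / 2) ∧ 2 * ((k + 1) / 2) ≤ k + 1 := by
  omega

/-- The wall column without truncated subtraction: `wallCol + i = 2c + 2⌈k/2⌉ + b` for `i ≤ k`.
[folklore] -/
theorem wallCol_add_row {k i : ℕ} (c : ℕ) (b : Bool) (hi : i ≤ k) :
    wallCol k i c b + i = 2 * c + 2 * ((k + 1) / 2) + (if b then 1 else 0) := by
  unfold wallCol
  have hk := two_mul_half_bounds k
  omega

/-- The wall column is in range. [folklore] -/
theorem wallCol_lt {k i c : ℕ} (hi : i ≤ k) (hc : c ≤ k) (b : Bool) : wallCol k i c b < 3 * k + 4 := by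
  have h := wallCol_add_row c b hi
  have hk := two_mul_half_bounds k
  cases b <;> simp at h <;> omega

/-- The embedding of the doubled cells into the vertices of the wall `W_{3k+3}`. [folklore] -/
def toWall (k : ℕ) (p : (Fin (k + 1) × Fin (k + 1)) × Bool) : Fin (3 * k + 3 + 1) × Fin (3 * k + 3 + 1) :=
  (⟨p.1.1, by have := p.1.1.isLt; omega⟩,
   ⟨wallCol k p.1.1 p.1.2 p.2, by
      have := wallCol_lt (k := k) (Nat.le_of_lt_succ p.1.1.isLt) (Nat.le_of_lt_succ p.1.2.isLt) p.2
      omega⟩)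

/-- For fixed row, the wall column determines the cell column and the side. [folklore] -/
theorem wallCol_injective {k i c c' : ℕ} {b b' : Bool} (hi : i ≤ k)
    (h : wallCol k i c b = wallCol k i c' b') : c = c' ∧ b = b' := by
  have h1 := wallCol_add_row c b hi
  have h2 := wallCol_add_row c' b' hi
  rw [h] at h1
  rw [h1] at h2
  cases b <;> cases b' <;> simp at h2 ⊢ <;> omega

/-- `toWall` is injective. [folklore] -/
theorem toWall_injective (k : ℕ) : Function.Injective (toWall k) := by
  rintro ⟨⟨i, c⟩, b⟩ ⟨⟨i', c'⟩, b'⟩ h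
  simp only [toWall, Prod.mk.injEq, Fin.mk.injEq] at h
  obtain ⟨hi, hcol⟩ := h
  have hii' : i = i' := Fin.ext hi
  subst hii'
  obtain ⟨hc, hb⟩ := wallCol_injective (Nat.le_of_lt_succ i.isLt) hcol
  have hcc' : c = c' := Fin.ext hc
  subst hcc'; subst hb; rfl

/-- The matching edge of a cell is a horizontal wall edge. [cite: GalesiEtAl2023, Lemma 16] -/
theorem wallCol_true (k i c : ℕ) : wallCol k i c true = wallCol k i c false + 1 := by
  simp [wallCol]

/-- The horizontal brick edge `((i,c),R) — ((i,c+1),L)` is a horizontal wall edge. [cite: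
GalesiEtAl2023, Lemma 16] -/
theorem wallCol_succ_false (k i c : ℕ) (hi : i ≤ k) :
    wallCol k i (c + 1) false = wallCol k i c true + 1 := by
  have h1 := wallCol_add_row (k := k) (c + 1) false hi
  have h2 := wallCol_add_row (k := k) c true hi
  simp at h1 h2
  omega

/-- The vertical brick edge `((i,c),L) — ((i+1,c),R)` is a vertical wall edge: same column, and
the parity condition of the wall holds. [cite: GalesiEtAl2023, Lemma 16] -/
theorem wallCol_vertical (k i c : ℕ) (hi : i + 1 ≤ k) :
    wallCol k (i + 1) c true = wallCol k i c false ∧ (i + wallCol k i c false) % 2 = 0 := by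
  have h1 := wallCol_add_row (k := k) c true hi
  have h2 := wallCol_add_row (k := k) (i := i) c false (by omega)
  simp at h1 h2
  omega

end Bricks

/-- **The brick graph is a subgraph of the wall** `W_{3k+3}`: the injective homomorphism
`((i,c), b) ↦ (i, 2c + 2⌈k/2⌉ - i + b)` (GIRS, Fig. 4–5: the wall contracted along
the matching of "horizontal edges in odd columns" is a sheared half-width grid; the shear
`-⌈i/2⌉` straightens it and the offset `⌈k/2⌉` keeps a `(k+1) × (k+1)` window inside).
[cite: GalesiEtAl2023, Lemma 16] -/
noncomputable def bricksHom (k : ℕ) : bricks k →g wall (3 * k + 3) where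
  toFun := Bricks.toWall k
  map_rel' := by
    rintro p q ⟨e, h⟩
    -- reduce to the oriented case
    suffices key : ∀ e : BEdge k, (wall (3 * k + 3)).Adj (Bricks.toWall k (lend e, false))
        (Bricks.toWall k (rend e, true)) by
      rcases h with ⟨rfl, rfl⟩ | ⟨rfl, rfl⟩
      · exact key e
      · exact (key e).symm
    intro e
    rcases e with ⟨i, c⟩ | ⟨⟨i, c⟩ | ⟨i, c⟩⟩
    · -- matching edge: horizontal wall edge
      refine Or.inl ⟨rfl, Or.inl ?_⟩
      simp [Bricks.toWall, lend, rend, Bricks.wallCol_true]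
    · -- horizontal grid edge `(i,c) — (i,c+1)`: left end `(i,c+1)`, right end `(i,c)`
      refine Or.inl ⟨rfl, Or.inr ?_⟩
      have := Bricks.wallCol_succ_false k i c (Nat.le_of_lt_succ i.isLt)
      simp [Bricks.toWall, lend, rend, this]
    · -- vertical grid edge `(i,c) — (i+1,c)`: left end `(i,c)`, right end `(i+1,c)`
      have := Bricks.wallCol_vertical k i c (by have := i.isLt; omega)
      refine Or.inr ⟨?_, Or.inl ⟨?_, ?_⟩⟩
      · simp [Bricks.toWall, lend, rend, this.1]
      · simp [Bricks.toWall, lend, rend]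
      · simpa [Bricks.toWall, lend, rend] using this.2

/-- `bricksHom` is injective. [folklore] -/
theorem bricksHom_injective (k : ℕ) : Function.Injective (bricksHom k) :=
  Bricks.toWall_injective k

/-- **The brick graph is a topological minor of every graph having the wall `W_{3k+3}` as a
topological minor.** [cite: GalesiEtAl2023, Cor. 9 and Lemma 16] -/
theorem bricks_isTopologicalMinor {β : Type*} {G : SimpleGraph β} {k : ℕ}
    (h : wall (3 * k + 3) ≼ₜ G) : bricks k ≼ₜ G :=
  h.of_hom (bricksHom k) (bricksHom_injective k)

/-! ### Sub-walls -/

/-- The coordinate inclusion of `W_a` into `W_b`, `a ≤ b`. [folklore] -/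
def wallInclFun {a b : ℕ} (h : a ≤ b) (p : Fin (a + 1) × Fin (a + 1)) : Fin (b + 1) × Fin (b + 1) :=
  (Fin.castLE (Nat.succ_le_succ h) p.1, Fin.castLE (Nat.succ_le_succ h) p.2)

/-- The coordinate inclusion is injective. [folklore] -/
theorem wallInclFun_injective {a b : ℕ} (h : a ≤ b) : Function.Injective (wallInclFun h) := by
  intro p q hpq
  simp only [wallInclFun, Prod.mk.injEq, Fin.castLE_inj] at hpq
  exact Prod.ext hpq.1 hpq.2

/-- **Sub-walls**: `W_a` is a subgraph of `W_b` for `a ≤ b` (same coordinates, same parities).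
[cite: GalesiEtAl2023, §2 (walls)] -/
def wallIncl {a b : ℕ} (h : a ≤ b) : wall a →g wall b where
  toFun := wallInclFun h
  map_rel' := by
    intro p q hpq
    simp only [wall_adj, wallInclFun, Fin.castLE_inj, Fin.val_castLE] at hpq ⊢
    exact hpq

/-- A graph having `W_b` as a topological minor has every `W_a`, `a ≤ b`. [folklore] -/
theorem wall_isTopologicalMinor_of_le {β : Type*} {G : SimpleGraph β} {a b : ℕ} (hab : a ≤ b)
    (h : wall b ≼ₜ G) : wall a ≼ₜ G :=
  h.of_hom (wallIncl hab) (wallInclFun_injective hab)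

end Literature.Computability.MetaComplexity
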